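import Summits.QuantumFields.YangMills.Theorems.BalabanLadderNTClassicalShadowOrbit
import Literature.MathematicalPhysics.QuantumLattice.LatticeGaugeDLRProofs
import HarnessLib

/-!
# Crux `NT` (stmt-QuantumFields-19353), stub `stub_refpkgT : RefPkgT`: THE CLASSICAL SHADOW, VI — kernel symmetries UP TO GAUGE
# (the non-abelian coherent exterior is swap-symmetric only up to a global colour rotation)

Helper file (`--supports stmt-QuantumFields-19353`) of the fleet lead prover of crux `NT` (unit `ym-spine-19353-p1`, GEN 14); sequel
of `…NTClassicalShadowOrbit` (p601276).

WHY.  The orbit test's symmetry hypothesis (S) — `kerE^η_β(F ∘ γ) = kerE^η_β(F)` — was supplied by the tree for a coordinate permutation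
`σ` fixing the box and the exterior EXACTLY (`kerE_perm_symm_fun`).  The cleanest symmetry-breaking family of the kit numerics (memo
SIZING-19353-g14 §2(d), family `na`: `U(x,1) = exp(iBx₀σ₃)`, `U(x,2) = exp(iBx₀σ₁)`) is invariant under the swap `1 ↔ 2` only up to the
global colour rotation exchanging `σ₃ ↔ σ₁`, i.e. `σ·η = g·η` for a gauge transformation `g`.  Gauge covariance of the kernels (tree:
`ymSpecification_map_gaugeTransformZd_holds`) and gauge invariance of the corner density close the gap:

* `dens_gaugeTransformZd` — `dens_x(g·U) = dens_x(U)` (`isZdGaugeInvariant_plaquetteObs`);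
* `kerE_gaugeTransformZd` — `kerE^{g·η}_β(F) = kerE^η_β(F ∘ g·)`;
* **`kerE_perm_gauge_symm_fun`** — if `sitePerm σ c = c` and `relabelConfig (edgePerm σ) η = gaugeTransformZd g η`, then
  `kerE^η_β(F ∘ σ·) = kerE^η_β(F)` for every gauge-INVARIANT observable `F`;
* `kerE_dens_perm_gauge_symm`, `kerE_dens_mul_perm_gauge_symm` — the one- and two-point instances (hypotheses `s₁, s₂, s₁₂` of
  `tendsto_kerCov_of_orbit` / `orbitCov_le_of_e2osc` for the permutation part of the symmetry group);
* **`contrast_le_of_e2osc_permValley_gauge`** — the two-valley price under a symmetry up to gauge.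

HONEST FRAMING.  Bookkeeping over tree theorems (gauge covariance + hypercubic covariance of the DLR kernels); the REFLECTION part of the
symmetry groups still lacks its covariance lemma (orientation-reversing relabellings of `ymSpecification`); no floor, not AF, not NT, not the
seam, not the gap; not Clay.
-/

set_option autoImplicit false

noncomputable section

open MeasureTheory Filter Topology
open Literature.MathematicalPhysics.QuantumFieldTheory Literature.MathematicalPhysics.QuantumLattice
open Literature.Probability.LatticeModels
open Summit.QuantumFields.YangMills.Cruxes.OSLegsFromFemtoAndGap.DlrCollarTransfer
open Summit.QuantumFields.YangMills.Cruxes.UVSeamRec.BoundaryLawPenetration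

namespace Summit.QuantumFields.YangMills.Cruxes.NT.ClassicalShadow

variable {G : Type} [Group G] [TopologicalSpace G] [IsTopologicalGroup G] [CompactSpace G]
  [MeasurableSpace G] [BorelSpace G] (r : LatticeRep G)

/-! ## §1 Gauge invariance of the density, gauge covariance of the kernels -/

/-- **The corner density is gauge invariant.** [folklore] -/
theorem dens_gaugeTransformZd (g : Site 4 → G) (x : Fin 4 → ℤ) (U : LGConfig 4 G) :
    dens G r x (gaugeTransformZd g U) = dens G r x U := by
  rw [dens_eq_sum_plaquetteObs, dens_eq_sum_plaquetteObs]
  refine Finset.sum_congr rfl fun i _ => Finset.sum_congr rfl fun j _ => ?_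
  split_ifs
  · exact isZdGaugeInvariant_plaquetteObs r.ρ x i j g U
  · rfl

/-- **Gauge covariance of the cube kernels**: `kerE^{g·η}_β(F) = kerE^η_β(F ∘ g·)` for measurable `F`. [folklore] -/
theorem kerE_gaugeTransformZd (β : ℝ) (c : Fin 4 → ℤ) (b : ℕ) (η : LGConfig 4 G) (g : Site 4 → G) {F : LGConfig 4 G → ℝ}
    (hF : Measurable F) :
    kerE G r β c b (gaugeTransformZd g η) F = kerE G r β c b η (F ∘ gaugeTransformZd g) := by
  haveI : SecondCountableTopology G := (Continuous.isClosedEmbedding r.continuous r.injective).isEmbedding.secondCountableTopology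
  unfold kerE
  rw [← ymSpecification_map_gaugeTransformZd_holds r.ρ r.continuous β (cubeEdges c b) η g,
    integral_map (measurable_gaugeTransformZd g).aemeasurable hF.aestronglyMeasurable]
  rfl

/-- **Kernel symmetry up to gauge.**  If the coordinate permutation `σ` fixes the cube base and maps the exterior to a GAUGE TRANSFORM of
itself, then `kerE^η_β(F ∘ σ·) = kerE^η_β(F)` for every continuous gauge-invariant `F`. [folklore] -/
theorem kerE_perm_gauge_symm_fun (σ : Equiv.Perm (Fin 4)) (β : ℝ) {c : Fin 4 → ℤ} (hc : sitePerm σ c = c) (b : ℕ)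
    {η : LGConfig 4 G} {g : Site 4 → G} (hη : relabelConfig (edgePerm σ) η = gaugeTransformZd g η) {F : LGConfig 4 G → ℝ}
    (hF : Continuous F) (hFg : IsZdGaugeInvariant F) :
    kerE G r β c b η (F ∘ relabelConfig (edgePerm σ)) = kerE G r β c b η F := by
  haveI : SecondCountableTopology G := (Continuous.isClosedEmbedding r.continuous r.injective).isEmbedding.secondCountableTopology
  have h := Summit.QuantumFields.YangMills.Cruxes.NT.BoundaryLaw.kerE_perm G r σ β c b η F
  rw [hc, hη, kerE_gaugeTransformZd r β c b η g hF.measurable] at h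
  rw [← h]
  congr 1
  funext U
  exact hFg g U

/-- One-point instance: `kerE^η_β(dens_{σx}) = kerE^η_β(dens_x)` under a symmetry up to gauge. [folklore] -/
theorem kerE_dens_perm_gauge_symm (σ : Equiv.Perm (Fin 4)) (β : ℝ) {c : Fin 4 → ℤ} (hc : sitePerm σ c = c) (b : ℕ)
    {η : LGConfig 4 G} {g : Site 4 → G} (hη : relabelConfig (edgePerm σ) η = gaugeTransformZd g η) (x : Fin 4 → ℤ) :
    kerE G r β c b η (dens G r (sitePerm σ x)) = kerE G r β c b η (dens G r x) := by
  rw [← kerE_perm_gauge_symm_fun r σ β hc b hη (continuous_dens r (sitePerm σ x)) (fun g' U => dens_gaugeTransformZd r g' _ U)]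
  congr 1
  funext U
  simp only [Function.comp_apply, dens_perm]

/-- Two-point instance: `kerE^η_β(dens_{σx}·dens_{σy}) = kerE^η_β(dens_x·dens_y)` under a symmetry up to gauge. [folklore] -/
theorem kerE_dens_mul_perm_gauge_symm (σ : Equiv.Perm (Fin 4)) (β : ℝ) {c : Fin 4 → ℤ} (hc : sitePerm σ c = c) (b : ℕ)
    {η : LGConfig 4 G} {g : Site 4 → G} (hη : relabelConfig (edgePerm σ) η = gaugeTransformZd g η) (x y : Fin 4 → ℤ) :
    kerE G r β c b η (fun U => dens G r (sitePerm σ x) U * dens G r (sitePerm σ y) U) =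
      kerE G r β c b η (fun U => dens G r x U * dens G r y U) := by
  have hc2 : Continuous fun U => dens G r (sitePerm σ x) U * dens G r (sitePerm σ y) U :=
    (continuous_dens r (sitePerm σ x)).mul (continuous_dens r (sitePerm σ y))
  have hgi : IsZdGaugeInvariant fun U => dens G r (sitePerm σ x) U * dens G r (sitePerm σ y) U := fun g' U => by
    simp only [dens_gaugeTransformZd]
  rw [← kerE_perm_gauge_symm_fun r σ β hc b hη hc2 hgi]
  congr 1
  funext U
  simp only [Function.comp_apply, dens_perm]

/-! ## §2 The two-valley price under a symmetry up to gauge -/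

section Price

variable (a : ℝ → ℝ)

/-- **Clause 2 against a two-valley ground state broken under a coordinate permutation that fixes the exterior up to gauge**:
`Δ²/4 ≤ C₂ / min(d_x, d_{σx})⁴ / (1 + ‖σx − x‖)⁴`. [folklore] -/
theorem contrast_le_of_e2osc_permValley_gauge (ha0 : Tendsto a atTop (𝓝 0)) {C₂ ℓ : ℝ} (hℓ : 0 < ℓ)
    (hE2 : ∃ β₂ : ℝ, ∀ β : ℝ, β₂ ≤ β → ∀ (c : Fin 4 → ℤ) (b : ℕ), (b : ℝ) * a β ≤ ℓ →
      ∀ (η η' : LGConfig 4 G) (x y : Fin 4 → ℤ), 1 ≤ depth c b x → 1 ≤ depth c b y →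
        |kerCov G r β c b η (dens G r x) (dens G r y) - kerCov G r β c b η' (dens G r x) (dens G r y)| ≤
          C₂ / ((min (depth c b x) (depth c b y) : ℕ) : ℝ) ^ 4 / (1 + ‖siteToE (y - x)‖) ^ 4)
    (σ : Equiv.Perm (Fin 4)) {c : Fin 4 → ℤ} (hc : sitePerm σ c = c) (b : ℕ) {η : LGConfig 4 G} {g : Site 4 → G}
    (hη : relabelConfig (edgePerm σ) η = gaugeTransformZd g η) {x : Fin 4 → ℤ} (hx : 2 ≤ depth c b x)
    (hy : 2 ≤ depth c b (sitePerm σ x)) {s Δ2 : ℝ}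
    (hsum : ∀ ζ ∈ cubeMinimisers G r c b η,
      dens G r x (glueWith (cubeEdges c b) ζ η) + dens G r (sitePerm σ x) (glueWith (cubeEdges c b) ζ η) = s)
    (hdiff : ∀ ζ ∈ cubeMinimisers G r c b η,
      (dens G r x (glueWith (cubeEdges c b) ζ η) - dens G r (sitePerm σ x) (glueWith (cubeEdges c b) ζ η)) ^ 2 = Δ2) :
    Δ2 / 4 ≤ C₂ / ((min (depth c b x) (depth c b (sitePerm σ x)) : ℕ) : ℝ) ^ 4 / (1 + ‖siteToE (sitePerm σ x - x)‖) ^ 4 :=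
  contrast_le_of_e2osc_twoValley r a ha0 hℓ hE2 c b hx hy η hsum hdiff fun β => (kerE_dens_perm_gauge_symm r σ β hc b hη x).symm

end Price

end Summit.QuantumFields.YangMills.Cruxes.NT.ClassicalShadow

end
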